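import Summits.BirchSwinnertonDyer.Uniform.U2.TwistTamagawaTwoAdicUnramified
import Literature.NumberTheory.DiophantineGeometry.ConductorMultiplicativeProofs
import HarnessLib

/-!
# Track U2 (cell `bsd-uniform`, seat u2-p1): the unramified twist of a MULTIPLICATIVE fibre stays
# multiplicative — at EVERY prime, `2` included — and the `2`-adic Tamagawa balance for bases
# multiplicative at `2` with odd `ord₂ Δ` when `d ≡ 5 (mod 8)`

HONEST FRAMING (cell `bsd-uniform`, HOME run/shared/lean/pub/bsd-uniform/): local arithmetic of
reduction types and Tamagawa numbers under quadratic twists; no claim about BSD beyond the displayed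
identities, nothing booked, no census number moves, no per-curve certificate is counted as a uniform
theorem. THIS FILE removes the hypothesis `p ≠ 2` from the seat's «`E^{(d)}` is multiplicative where
`E` is» (`hasMultiplicativeReductionAtPrime_of_twist_of_not_dvd`, p522556 — its proof twists a
`ℤ_p`-minimal equation by the unit `d`, which needs `2 ∈ ℤ_pˣ`): for `d = 4k + 1` and `p ∤ d` the
INTEGRAL twist model «completing the square» (`WeierstrassCurve.twistModel`, tree
`QuadraticTwistIntegralModel` / `QuadraticTwistMinimalModelProofs`) has the same conductor exponent as
`E` at `p` (`conductorExponent_twistModel`: same `ord_p Δ_min`, same Kodaira symbol — Comalada 1994 §2,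
Silverman *ATAEC* IV.9.4), and `f_p = 1` characterises multiplicative reduction
(`conductorExponent_eq_one_iff_holds`, *ATAEC* IV.10.2(b)). Consequence for the U2 heads: at `p = 2`
with `d ≡ 5 (mod 8)` a base with MULTIPLICATIVE reduction at `2` and ODD `ord₂ Δ` has
`c₂(E)`, `c₂(E^{(d)})` both odd (Tate's algorithm, type `Iₙ`, `n` odd), so the `2`-adic Tamagawa
balance holds under the third disjunct of HOME/RESIDUE.md R-A3′ as well: the balance's `2`-adic class
condition becomes EXACTLY «`d ≡ 1 (mod 8)` OR good at `2` OR (multiplicative at `2` with `ord₂ Δ`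
odd)» — Mazur–Rubin's Lemma 2.10 (i) / (v) / (iii) at the prime `2`.

## Contents (theorems only; no `def`, no named fact)
* `hasMultiplicativeReductionAt_twist_of_not_dvd` — place-indexed, any residue characteristic.
* `hasMultiplicativeReductionAtPrime_twist_of_not_dvd` — prime-indexed wrapper (`p = 2` allowed).
* `padicValNat_two_localTamagawaNumber_twist_eq_of_ne_two` — odd primes, no hypothesis at `2`.
* `padicValNat_two_localTamagawaNumber_two_twist_eq` — the prime `2` under the three disjuncts.
* **`padicValNat_two_tamagawaProduct_twist_eq_of_lemma210`** — `ord₂ ∏ c_ℓ(E^{(d)}) = ord₂ ∏ c_ℓ(E)`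
  under `hS`, `hadd`/`hmev`, `d ≡ 1 (mod 4)` and the three disjuncts at `2`.

References: Silverman *ATAEC* (1994) IV.9.4, IV.10.2(b), Cor. IV.9.2(d) [SilvermanATAEC1994];
Silverman *AEC* 2nd ed. (2009) VII.1 Prop. 1.3, VII.5 Prop. 5.1, X.5 Cor. 5.4 [SilvermanAEC2009];
Comalada, *Twists and reduction of an elliptic curve*, J. Number Theory 49 (1994) §2 [Comalada1994];
Mazur–Rubin 2010 Lemma 2.10 [MazurRubin2010]; HOME/RESIDUE.md R-A3′ / R-A7.
-/

set_option autoImplicit false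

noncomputable section

open scoped Classical

open IsDedekindDomain IsDedekindDomain.HeightOneSpectrum NumberField Rat.HeightOneSpectrum
  WeierstrassCurve Literature.NumberTheory.EllipticCurves Literature.NumberTheory.DiophantineGeometry

namespace Summit.BirchSwinnertonDyer.Uniform.U2

/-! ## §1 Multiplicative reduction is preserved by a twist unramified at `v` — every `v` -/

/-- **Multiplicative reduction is preserved by a quadratic twist unramified at `v`** — for EVERY
residue characteristic, `ℓ = 2` included: for `W/ℚ` elliptic with multiplicative reduction at the
place `v` over `ℓ`, an integer `D = 4k + 1` with `ℓ ∤ D`, and any equation `Wd = Cd • W^{(D)}`, `Wd`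
has multiplicative reduction at `v`. The twisted equation is `ℚ`-isomorphic to the integral twist
model `W.twistModel k` (`exists_variableChange_twistModel_eq_quadraticTwist`), whose conductor exponent
at `v` equals that of `W` because `k` is `v`-integral and `4k + 1` is a `v`-unit
(`conductorExponent_twistModel`); and `f_v = 1` iff multiplicative reduction (*ATAEC* IV.10.2(b),
`conductorExponent_eq_one_iff_holds`); multiplicative reduction is invariant under `ℚ`-isomorphism
(`hasMultiplicativeReductionAt_smul_iff_holds`). [cite: SilvermanATAEC1994, IV.9.4 and IV.10.2(b)]
[cite: SilvermanAEC2009, VII.1 Prop. 1.3 and VII.5 Prop. 5.1(b)] -/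
theorem hasMultiplicativeReductionAt_twist_of_not_dvd (W : WeierstrassCurve ℚ) [W.IsElliptic]
    (v : HeightOneSpectrum (𝓞 ℚ)) {D k : ℤ} (hDk : D = 4 * k + 1)
    (hvD : ¬ ((primesEquiv v : ℕ) : ℤ) ∣ D) (hmult : W.HasMultiplicativeReductionAt v)
    {Wd : WeierstrassCurve ℚ} [Wd.IsElliptic] (Cd : VariableChange ℚ)
    (hWd : Cd • W.quadraticTwist (D : ℚ) = Wd) : Wd.HasMultiplicativeReductionAt v := by
  haveI : Finite (IsLocalRing.ResidueField (v.adicCompletionIntegers ℚ)) :=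
    HeightOneSpectrum.finite_residueField_adicCompletionIntegers ℚ v
  haveI : PerfectField (IsLocalRing.ResidueField (v.adicCompletionIntegers ℚ)) :=
    PerfectField.ofFinite
  -- the twist model and its parameters at `v`
  have hk : v.valuation ℚ (k : ℚ) ≤ 1 := valuation_ringOfIntegers_intCast_le_one v k
  have hd : v.valuation ℚ (4 * (k : ℚ) + 1) = 1 := by
    have h := valuation_ringOfIntegers_intCast_eq_one v hvD
    rw [hDk] at h
    push_cast at h
    exact h
  -- `W^{(D)} = C • W.twistModel k`
  obtain ⟨C, -, hC⟩ := exists_variableChange_twistModel_eq_quadraticTwist W (k : ℚ)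
  have hDq : (4 * (k : ℚ) + 1) = (D : ℚ) := by rw [hDk]; push_cast; ring
  rw [hDq] at hC
  have hD0 : (D : ℚ) ≠ 0 := by
    intro h0
    rw [← hDq] at h0
    rw [h0, map_zero] at hd
    exact zero_ne_one hd
  haveI : (W.quadraticTwist (D : ℚ)).IsElliptic := W.isElliptic_quadraticTwist hD0
  haveI : (W.twistModel (k : ℚ)).IsElliptic := by
    have h : C⁻¹ • W.quadraticTwist (D : ℚ) = W.twistModel (k : ℚ) := by
      rw [← hC, smul_smul, inv_mul_cancel, one_smul]
    rw [← h]; infer_instance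
  -- `f_v(W) = 1`, hence `f_v(twist model) = 1`, hence the twist model is multiplicative at `v`
  have hiffW : W.conductorExponent v = 1 ↔ W.HasMultiplicativeReductionAt v :=
    conductorExponent_eq_one_iff_holds v W
  have hiffT : (W.twistModel (k : ℚ)).conductorExponent v = 1 ↔
      (W.twistModel (k : ℚ)).HasMultiplicativeReductionAt v :=
    conductorExponent_eq_one_iff_holds v (W.twistModel (k : ℚ))
  have hfT : (W.twistModel (k : ℚ)).conductorExponent v = 1 := by
    rw [conductorExponent_twistModel v W hk hd]
    exact hiffW.mpr hmult
  have hmultT : (W.twistModel (k : ℚ)).HasMultiplicativeReductionAt v := hiffT.mp hfT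
  have hmultX : (W.quadraticTwist (D : ℚ)).HasMultiplicativeReductionAt v := by
    rw [← hC]
    exact (hasMultiplicativeReductionAt_smul_iff_holds v (W.twistModel (k : ℚ)) C).mpr hmultT
  rw [← hWd]
  exact (hasMultiplicativeReductionAt_smul_iff_holds v (W.quadraticTwist (D : ℚ)) Cd).mpr hmultX

/-- **`E^{(D)}` is multiplicative at a prime `p ∤ D` where `E` is** (`D ≡ 1 (mod 4)`; ANY `p`, `2`
included): prime-indexed form of `hasMultiplicativeReductionAt_twist_of_not_dvd` (bridge
`hasMultiplicativeReductionAtPrime_iff_hasMultiplicativeReductionAt_ringOfIntegers`).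
[cite: SilvermanATAEC1994, IV.9.4 and IV.10.2(b)] [cite: SilvermanAEC2009, VII.5 Prop. 5.1(b)] -/
theorem hasMultiplicativeReductionAtPrime_twist_of_not_dvd (W : WeierstrassCurve ℚ) [W.IsElliptic]
    (p : ℕ) [hp : Fact p.Prime] {D k : ℤ} (hDk : D = 4 * k + 1) (hpD : ¬ (p : ℤ) ∣ D)
    (hmult : W.HasMultiplicativeReductionAtPrime p) {Wd : WeierstrassCurve ℚ} [Wd.IsElliptic]
    (Cd : VariableChange ℚ) (hWd : Cd • W.quadraticTwist (D : ℚ) = Wd) :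
    Wd.HasMultiplicativeReductionAtPrime p := by
  set v : HeightOneSpectrum (𝓞 ℚ) := (primesEquiv (R := 𝓞 ℚ)).symm ⟨p, hp.out⟩ with hvdef
  have hv : primesEquiv v = ⟨p, hp.out⟩ := Equiv.apply_symm_apply _ _
  have hvp : (primesEquiv v : ℕ) = p := congrArg Subtype.val hv
  have key₁ : ∀ q : Nat.Primes, primesEquiv v = q →
      (haveI := Fact.mk q.2; W.HasMultiplicativeReductionAtPrime (q : ℕ)) →
        W.HasMultiplicativeReductionAt v := by
    rintro q rfl h
    exact (hasMultiplicativeReductionAtPrime_iff_hasMultiplicativeReductionAt_ringOfIntegers W v).mp h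
  have hmultv : W.HasMultiplicativeReductionAt v := key₁ ⟨p, hp.out⟩ hv hmult
  have hmultd : Wd.HasMultiplicativeReductionAt v :=
    hasMultiplicativeReductionAt_twist_of_not_dvd W v hDk (by rw [hvp]; exact hpD) hmultv Cd hWd
  have key₂ : ∀ q : Nat.Primes, primesEquiv v = q → Wd.HasMultiplicativeReductionAt v →
      (haveI := Fact.mk q.2; Wd.HasMultiplicativeReductionAtPrime (q : ℕ)) := by
    rintro q rfl h
    exact (hasMultiplicativeReductionAtPrime_iff_hasMultiplicativeReductionAt_ringOfIntegers Wd v).mpr h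
  exact key₂ ⟨p, hp.out⟩ hv hmultd

/-! ## §2 Prime by prime: odd primes need nothing at `2` -/

/-- **`ord₂ c_ℓ(E^{(d)}) = ord₂ c_ℓ(E)` at every ODD prime `ℓ`**, for `W / ℚ` globally minimal,
`d ≡ 1 (mod 4)` with every prime `q ∣ d` good and `a_q` odd (`hS`), and at `ℓ` (if bad) EITHER
`(d/ℓ) = 1` OR `ℓ` multiplicative with `ord_ℓ(Δ)` odd (`hℓ`); `W₁` ANY model of `E^{(d)}`; NO
hypothesis at the prime `2`. (The odd-prime branches of
`padicValNat_two_localTamagawaNumber_twist_eq_of_unramified`, p528455, verbatim.)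
[cite: SilvermanATAEC1994, Cor. IV.9.2(d) and IV.9.4 Step 2]
[cite: SilvermanAEC2009, VII.1 Prop. 1.3, VII.5 Prop. 5.1, VII.6 and X.5 Cor. 5.4]
[cite: MazurRubin2010, Lemma 2.10 (ii), (iii), (v)] -/
theorem padicValNat_two_localTamagawaNumber_twist_eq_of_ne_two (W : WeierstrassCurve ℚ)
    [W.IsElliptic] [W.IsGloballyMinimal] {d : ℤ} (hd4 : d % 4 = 1)
    (hS : ∀ (q : ℕ), q.Prime → (q : ℤ) ∣ d →
      ¬ (q : ℤ) ∣ minimalDiscriminantInt W ∧ Odd (W.frobeniusTrace q))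
    {W₁ : WeierstrassCurve ℚ} [W₁.IsElliptic]
    (h₁ : ∃ C : VariableChange ℚ, C • W₁ = W.quadraticTwist (d : ℚ)) (ℓ : ℕ) [Fact ℓ.Prime]
    (hℓ2 : ℓ ≠ 2)
    (hℓ : ℓ ∣ W.conductorNorm ℤ →
      jacobiSym d ℓ = 1 ∨ (W.HasMultiplicativeReductionAtPrime ℓ ∧ Odd (padicValRat ℓ W.Δ))) :
    padicValNat 2 ((W₁.baseChange ℚ_[ℓ]).localTamagawaNumber ℤ_[ℓ]) =
      padicValNat 2 ((W.baseChange ℚ_[ℓ]).localTamagawaNumber ℤ_[ℓ]) := by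
  have hℓP : ℓ.Prime := Fact.out
  have hd0 : d ≠ 0 := by rintro rfl; norm_num at hd4
  have hdQ : (d : ℚ) ≠ 0 := by exact_mod_cast hd0
  obtain ⟨C, hC⟩ := h₁
  have hWd : C⁻¹ • W.quadraticTwist (d : ℚ) = W₁ := by rw [← hC, inv_smul_smul]
  haveI : (W.baseChange ℚ_[ℓ]).IsElliptic := inferInstanceAs (W.map (algebraMap ℚ ℚ_[ℓ])).IsElliptic
  haveI : (W₁.baseChange ℚ_[ℓ]).IsElliptic := inferInstanceAs (W₁.map (algebraMap ℚ ℚ_[ℓ])).IsElliptic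
  haveI : (W.quadraticTwist (d : ℚ)).IsElliptic := W.isElliptic_quadraticTwist hdQ
  by_cases hℓN : ℓ ∣ W.conductorNorm ℤ
  · rcases hℓ hℓN with hj | ⟨hmult, hodd⟩
    · -- `(d/ℓ) = 1`: `d` is a square in `ℚ_ℓ`, the two curves are `ℚ_ℓ`-isomorphic
      obtain ⟨θ, hθ⟩ := padic_isSquare_of_jacobiSym_eq_one hℓ2 hj
      have hθ0 : θ ≠ 0 := by
        rintro rfl
        rw [mul_zero] at hθ
        exact hd0 (by exact_mod_cast hθ)
      obtain ⟨C', hC'⟩ := (W.baseChange ℚ_[ℓ]).exists_variableChange_smul_eq_quadraticTwist_sq hθ0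
      have h1 : (W.quadraticTwist (d : ℚ)).baseChange ℚ_[ℓ] = C' • W.baseChange ℚ_[ℓ] := by
        rw [hC', WeierstrassCurve.baseChange, WeierstrassCurve.baseChange, map_quadraticTwist, sq,
          map_intCast, hθ]
      have hYX : W₁.baseChange ℚ_[ℓ] =
          (C⁻¹.map (algebraMap ℚ ℚ_[ℓ]) * C') • W.baseChange ℚ_[ℓ] := by
        rw [← hWd, WeierstrassCurve.VariableChange.baseChange_smul_eq (W.quadraticTwist (d : ℚ))
          C⁻¹ ℚ_[ℓ], h1, mul_smul]
      rw [hYX, localTamagawaNumber_variableChange_holds ℤ_[ℓ] (W.baseChange ℚ_[ℓ])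
        (C⁻¹.map (algebraMap ℚ ℚ_[ℓ]) * C')]
    · -- `ℓ` multiplicative with `ord_ℓ(Δ)` odd — both Tamagawa numbers are odd
      have hℓd : ¬ (ℓ : ℤ) ∣ d := fun h => by
        have hgood : W.HasGoodReductionAtPrime ℓ :=
          hasGoodReductionAtPrime_of_not_dvd W ℓ (hS ℓ hℓP h).1
        exact WeierstrassCurve.HasMultiplicativeReduction.not_hasGoodReduction (R := ℤ_[ℓ]) hmult hgood
      have hoddW : Odd ((W.baseChange ℚ_[ℓ]).localTamagawaNumber ℤ_[ℓ]) := by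
        refine odd_localTamagawaNumber_padic_of_mult_of_odd W ℓ hmult ?_
        rw [← cast_minimalDiscriminantInt W, padicValRat.of_int] at hodd
        exact (Int.odd_coe_nat _).mp hodd
      obtain ⟨W₁', hW₁'e, hW₁'m, C₁, hC₁⟩ := exists_isGloballyMinimal_smul_eq_quadraticTwist W hdQ
      haveI := hW₁'e
      haveI := hW₁'m
      have hmult' : W₁'.HasMultiplicativeReductionAtPrime ℓ :=
        hasMultiplicativeReductionAtPrime_of_twist_of_not_dvd W ℓ hℓ2 hd0 hℓd ⟨C₁, hC₁⟩ hmult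
      have hodd' : Odd (padicValInt ℓ W₁'.minimalDiscriminantInt) := by
        have h := (even_padicValRat_Δ_iff_of_twist W W₁' hdQ ⟨C₁, hC₁⟩ ℓ).not.mpr
          (Int.not_even_iff_odd.mpr hodd)
        rw [← cast_minimalDiscriminantInt W₁', padicValRat.of_int] at h
        exact (Int.odd_coe_nat _).mp (Int.not_even_iff_odd.mp h)
      have hoddW₁' : Odd ((W₁'.baseChange ℚ_[ℓ]).localTamagawaNumber ℤ_[ℓ]) :=
        odd_localTamagawaNumber_padic_of_mult_of_odd W₁' ℓ hmult' hodd'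
      haveI : (W₁'.baseChange ℚ_[ℓ]).IsElliptic :=
        inferInstanceAs (W₁'.map (algebraMap ℚ ℚ_[ℓ])).IsElliptic
      have hW₁W₁' : W₁ = (C⁻¹ * C₁) • W₁' := by rw [mul_smul, hC₁, hWd]
      have hloc : (W₁.baseChange ℚ_[ℓ]).localTamagawaNumber ℤ_[ℓ] =
          (W₁'.baseChange ℚ_[ℓ]).localTamagawaNumber ℤ_[ℓ] := by
        rw [hW₁W₁', WeierstrassCurve.VariableChange.baseChange_smul_eq W₁' (C⁻¹ * C₁) ℚ_[ℓ],
          localTamagawaNumber_variableChange_holds ℤ_[ℓ] (W₁'.baseChange ℚ_[ℓ])]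
      rw [hloc, padicValNat.eq_zero_of_not_dvd (Nat.two_dvd_ne_zero.mpr (Nat.odd_iff.mp hoddW₁')),
        padicValNat.eq_zero_of_not_dvd (Nat.two_dvd_ne_zero.mpr (Nat.odd_iff.mp hoddW))]
  · -- `ℓ ∤ N`: `W` is good at `ℓ`, `c_ℓ(W) = 1`
    have hgood : W.HasGoodReductionAtPrime ℓ := by
      by_contra h
      exact hℓN ((W.dvd_conductorNorm_iff_not_hasGoodReductionAtPrime ℓ).mpr h)
    have hcW : (W.baseChange ℚ_[ℓ]).localTamagawaNumber ℤ_[ℓ] = 1 := by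
      haveI : ((W.baseChange ℚ_[ℓ]).minimal ℤ_[ℓ]).HasGoodReduction ℤ_[ℓ] := hgood
      exact localTamagawaNumber_eq_one_of_hasGoodReduction_holds ℤ_[ℓ] _
    rw [hcW, padicValNat_one_right]
    by_cases hℓd : (ℓ : ℤ) ∣ d
    · -- `ℓ = q ∣ d`: `E(ℚ_q)[2] = 0` (a_q odd) ⇒ `E^{(d)}(ℚ_q)[2] = 0` ⇒ `c_q(E^{(d)})` odd
      obtain ⟨hℓΔ, hodd⟩ := hS ℓ hℓP hℓd
      have hE : ∀ Q : (W.baseChange ℚ_[ℓ]).toAffine.Point, 2 • Q = 0 → Q = 0 :=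
        (forall_two_nsmul_eq_zero_iff_odd_frobeniusTrace W hℓ2 hℓΔ).mpr hodd
      obtain ⟨W₁', hW₁'e, hW₁'m, C₁, hC₁⟩ := exists_isGloballyMinimal_smul_eq_quadraticTwist W hdQ
      haveI := hW₁'e
      haveI := hW₁'m
      have hE' : ∀ Q : (W₁'.baseChange ℚ_[ℓ]).toAffine.Point, 2 • Q = 0 → Q = 0 :=
        (TwoTorsionField.forall_two_nsmul_eq_zero_iff_of_twist W hdQ W₁' ⟨C₁, hC₁⟩).mp hE
      have hc₁odd := ((forall_two_nsmul_eq_zero_iff_odd_tamagawa_and_odd_frobeniusTrace W₁' ℓ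
        hℓ2).mp hE').1
      haveI : (W₁'.baseChange ℚ_[ℓ]).IsElliptic :=
        inferInstanceAs (W₁'.map (algebraMap ℚ ℚ_[ℓ])).IsElliptic
      have hW₁W₁' : W₁ = (C⁻¹ * C₁) • W₁' := by rw [mul_smul, hC₁, hWd]
      have hloc : (W₁.baseChange ℚ_[ℓ]).localTamagawaNumber ℤ_[ℓ] =
          (W₁'.baseChange ℚ_[ℓ]).localTamagawaNumber ℤ_[ℓ] := by
        rw [hW₁W₁', WeierstrassCurve.VariableChange.baseChange_smul_eq W₁' (C⁻¹ * C₁) ℚ_[ℓ],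
          localTamagawaNumber_variableChange_holds ℤ_[ℓ] (W₁'.baseChange ℚ_[ℓ])]
      rw [hloc]
      exact padicValNat.eq_zero_of_not_dvd (Nat.two_dvd_ne_zero.mpr (Nat.odd_iff.mp hc₁odd))
    · -- `ℓ ∤ N d`: unramified twist, good reduction preserved, `c_ℓ = 1`
      have h4 : d = 4 * (d / 4) + 1 := by omega
      rw [Rank1Residual.X2.localTamagawaNumber_twist_of_not_dvd W ℓ h4 hℓd hgood C⁻¹ hWd,
        padicValNat_one_right]

/-! ## §3 At the prime `2`: Lemma 2.10 (i) / (v) / (iii) -/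

/-- **`ord₂ c₂(E^{(d)}) = ord₂ c₂(E)`** for `W / ℚ` globally minimal, `d ≡ 1 (mod 4)`, `W₁` any model
of `E^{(d)}`, under one of: `d ≡ 1 (mod 8)`; `E` good at `2`; `E` multiplicative at `2` with
`ord₂(Δ)` odd (then both Tamagawa numbers at `2` are odd: type `Iₙ`, `n` odd, for `E` and — by §1 —
for `E^{(d)}`). [cite: SilvermanATAEC1994, Cor. IV.9.2(d), IV.9.4 Step 2 and IV.10.2(b)]
[cite: SilvermanAEC2009, VII.1 Prop. 1.3, VII.5 Prop. 5.1] [cite: MazurRubin2010, Lemma 2.10 (i), (iii), (v)] -/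
theorem padicValNat_two_localTamagawaNumber_two_twist_eq (W : WeierstrassCurve ℚ)
    [W.IsElliptic] [W.IsGloballyMinimal] {d : ℤ} (hd4 : d % 4 = 1)
    (h2 : d % 8 = 1 ∨ W.HasGoodReductionAtPrime 2 ∨
      (W.HasMultiplicativeReductionAtPrime 2 ∧ Odd (padicValRat 2 W.Δ)))
    (hS : ∀ (q : ℕ), q.Prime → (q : ℤ) ∣ d →
      ¬ (q : ℤ) ∣ minimalDiscriminantInt W ∧ Odd (W.frobeniusTrace q))
    {W₁ : WeierstrassCurve ℚ} [W₁.IsElliptic]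
    (h₁ : ∃ C : VariableChange ℚ, C • W₁ = W.quadraticTwist (d : ℚ)) :
    padicValNat 2 ((W₁.baseChange ℚ_[2]).localTamagawaNumber ℤ_[2]) =
      padicValNat 2 ((W.baseChange ℚ_[2]).localTamagawaNumber ℤ_[2]) := by
  haveI : Fact (Nat.Prime 2) := ⟨Nat.prime_two⟩
  have hd0 : d ≠ 0 := by rintro rfl; norm_num at hd4
  have hdQ : (d : ℚ) ≠ 0 := by exact_mod_cast hd0
  rcases h2 with h8 | hgood | ⟨hmult2, hodd2⟩
  · exact padicValNat_two_localTamagawaNumber_twist_eq_of_unramified W hd4 (Or.inl h8) hS h₁ 2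
      (fun _ h => absurd rfl h)
  · exact padicValNat_two_localTamagawaNumber_twist_eq_of_unramified W hd4 (Or.inr hgood) hS h₁ 2
      (fun _ h => absurd rfl h)
  · obtain ⟨C, hC⟩ := h₁
    have hWd : C⁻¹ • W.quadraticTwist (d : ℚ) = W₁ := by rw [← hC, inv_smul_smul]
    haveI : (W.baseChange ℚ_[2]).IsElliptic := inferInstanceAs (W.map (algebraMap ℚ ℚ_[2])).IsElliptic
    haveI : (W₁.baseChange ℚ_[2]).IsElliptic :=
      inferInstanceAs (W₁.map (algebraMap ℚ ℚ_[2])).IsElliptic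
    have h4 : d = 4 * (d / 4) + 1 := by omega
    have h2d : ¬ ((2 : ℕ) : ℤ) ∣ d := by omega
    -- `c₂(E)` odd
    have hoddW : Odd ((W.baseChange ℚ_[2]).localTamagawaNumber ℤ_[2]) := by
      refine odd_localTamagawaNumber_padic_of_mult_of_odd W 2 hmult2 ?_
      rw [← cast_minimalDiscriminantInt W, padicValRat.of_int] at hodd2
      exact (Int.odd_coe_nat _).mp hodd2
    -- a globally minimal model of the twist, multiplicative at `2` with `ord₂(Δ)` odd
    obtain ⟨W₁', hW₁'e, hW₁'m, C₁, hC₁⟩ := exists_isGloballyMinimal_smul_eq_quadraticTwist W hdQ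
    haveI := hW₁'e
    haveI := hW₁'m
    have hWd' : C₁⁻¹ • W.quadraticTwist (d : ℚ) = W₁' := by rw [← hC₁, inv_smul_smul]
    have hmult' : W₁'.HasMultiplicativeReductionAtPrime 2 :=
      hasMultiplicativeReductionAtPrime_twist_of_not_dvd W 2 h4 h2d hmult2 C₁⁻¹ hWd'
    have hodd' : Odd (padicValInt 2 W₁'.minimalDiscriminantInt) := by
      have h := (even_padicValRat_Δ_iff_of_twist W W₁' hdQ ⟨C₁, hC₁⟩ 2).not.mpr
        (Int.not_even_iff_odd.mpr hodd2)
      rw [← cast_minimalDiscriminantInt W₁', padicValRat.of_int] at h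
      exact (Int.odd_coe_nat _).mp (Int.not_even_iff_odd.mp h)
    have hoddW₁' : Odd ((W₁'.baseChange ℚ_[2]).localTamagawaNumber ℤ_[2]) :=
      odd_localTamagawaNumber_padic_of_mult_of_odd W₁' 2 hmult' hodd'
    -- `W₁ ≅ W₁'` over `ℚ`, so `c₂(W₁) = c₂(W₁')`
    haveI : (W₁'.baseChange ℚ_[2]).IsElliptic :=
      inferInstanceAs (W₁'.map (algebraMap ℚ ℚ_[2])).IsElliptic
    have hW₁W₁' : W₁ = (C⁻¹ * C₁) • W₁' := by rw [mul_smul, hC₁, hWd]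
    have hloc : (W₁.baseChange ℚ_[2]).localTamagawaNumber ℤ_[2] =
        (W₁'.baseChange ℚ_[2]).localTamagawaNumber ℤ_[2] := by
      rw [hW₁W₁', WeierstrassCurve.VariableChange.baseChange_smul_eq W₁' (C⁻¹ * C₁) ℚ_[2],
        localTamagawaNumber_variableChange_holds ℤ_[2] (W₁'.baseChange ℚ_[2])]
    rw [hloc, padicValNat.eq_zero_of_not_dvd (Nat.two_dvd_ne_zero.mpr (Nat.odd_iff.mp hoddW₁')),
      padicValNat.eq_zero_of_not_dvd (Nat.two_dvd_ne_zero.mpr (Nat.odd_iff.mp hoddW))]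

/-! ## §4 The `2`-adic Tamagawa balance under Lemma 2.10 (i) / (v) / (iii) at `2` -/

/-- `ord_p` of a finite product of non-zero naturals is the sum of the `ord_p`. [folklore] -/
private theorem padicValNat_finset_prod₅ (p : ℕ) [Fact p.Prime] {ι : Type*} (s : Finset ι)
    (f : ι → ℕ) (hf : ∀ i ∈ s, f i ≠ 0) :
    padicValNat p (∏ i ∈ s, f i) = ∑ i ∈ s, padicValNat p (f i) := by
  induction s using Finset.induction_on with
  | empty => simp
  | insert a s ha ih =>
    rw [Finset.prod_insert ha, Finset.sum_insert ha,
      padicValNat.mul (hf a (Finset.mem_insert_self a s))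
        (Finset.prod_ne_zero_iff.mpr fun i hi => hf i (Finset.mem_insert_of_mem hi)),
      ih fun i hi => hf i (Finset.mem_insert_of_mem hi)]

/-- **`ord₂ ∏_ℓ c_ℓ(E^{(d)}) = ord₂ ∏_ℓ c_ℓ(E)` for `d ≡ 1 (mod 4)`, under Mazur–Rubin's Lemma 2.10
(i) / (v) / (iii) at the prime `2`** («`d ≡ 1 (mod 8)`» OR «`E` good at `2`» OR «`E` multiplicative at
`2` with `ord₂(Δ)` odd») — the per-twist-pair Tamagawa balance `hc` of the U2 heads as a CLASS THEOREM
on the a_q-odd class with EXACTLY the complement of HOME/RESIDUE.md R-A3′ at `2` (bases additive at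
`2`, or multiplicative at `2` with even `ord₂ Δ`, still need `d ≡ 1 (mod 8)`): `W / ℚ` globally
minimal elliptic, `hS`, `hadd`/`hmev` verbatim the binders of the heads; `W₁` ANY model of `E^{(d)}`.
[cite: SilvermanATAEC1994, Cor. IV.9.2(d), IV.9.4 Step 2 and IV.10.2(b)]
[cite: SilvermanAEC2009, VII.1 Prop. 1.3, VII.5 Prop. 5.1, VII.6 and X.5 Cor. 5.4]
[cite: MazurRubin2010, Prop. 3.3 and Lemma 2.10 (i), (ii), (iii), (v)] -/
theorem padicValNat_two_tamagawaProduct_twist_eq_of_lemma210 (W : WeierstrassCurve ℚ)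
    [W.IsElliptic] [W.IsGloballyMinimal] {d : ℤ} (hd4 : d % 4 = 1)
    (h2 : d % 8 = 1 ∨ W.HasGoodReductionAtPrime 2 ∨
      (W.HasMultiplicativeReductionAtPrime 2 ∧ Odd (padicValRat 2 W.Δ)))
    (hS : ∀ (q : ℕ), q.Prime → (q : ℤ) ∣ d →
      ¬ (q : ℤ) ∣ minimalDiscriminantInt W ∧ Odd (W.frobeniusTrace q))
    (hadd : ∀ (p : ℕ) [Fact p.Prime], ¬ W.HasGoodReductionAtPrime p →
      ¬ W.HasMultiplicativeReductionAtPrime p → p ≠ 2 → jacobiSym d p = 1)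
    (hmev : ∀ (p : ℕ) [Fact p.Prime], W.HasMultiplicativeReductionAtPrime p →
      Even (padicValRat p W.Δ) → p ≠ 2 → jacobiSym d p = 1)
    {W₁ : WeierstrassCurve ℚ} [W₁.IsElliptic]
    (h₁ : ∃ C : VariableChange ℚ, C • W₁ = W.quadraticTwist (d : ℚ)) :
    padicValNat 2 W₁.tamagawaProduct = padicValNat 2 W.tamagawaProduct := by
  haveI : Fact (Nat.Prime 2) := ⟨Nat.prime_two⟩
  -- the per-prime hypothesis of §2 from `hadd` / `hmev`
  have hℓ : ∀ (ℓ : ℕ) [Fact ℓ.Prime], ℓ ≠ 2 → ℓ ∣ W.conductorNorm ℤ →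
      jacobiSym d ℓ = 1 ∨ (W.HasMultiplicativeReductionAtPrime ℓ ∧ Odd (padicValRat ℓ W.Δ)) := by
    intro ℓ _ hℓ2 hℓN
    by_cases hm : W.HasMultiplicativeReductionAtPrime ℓ
    · by_cases he : Even (padicValRat ℓ W.Δ)
      · exact Or.inl (hmev ℓ hm he hℓ2)
      · exact Or.inr ⟨hm, Int.not_even_iff_odd.mp he⟩
    · exact Or.inl (hadd ℓ ((W.dvd_conductorNorm_iff_not_hasGoodReductionAtPrime ℓ).mp hℓN) hm hℓ2)
  have hprime : ∀ (ℓ : ℕ) [Fact ℓ.Prime],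
      padicValNat 2 ((W₁.baseChange ℚ_[ℓ]).localTamagawaNumber ℤ_[ℓ]) =
        padicValNat 2 ((W.baseChange ℚ_[ℓ]).localTamagawaNumber ℤ_[ℓ]) := by
    intro ℓ _
    by_cases hℓ2 : ℓ = 2
    · subst hℓ2
      exact padicValNat_two_localTamagawaNumber_two_twist_eq W hd4 h2 hS h₁
    · exact padicValNat_two_localTamagawaNumber_twist_eq_of_ne_two W hd4 hS h₁ ℓ hℓ2 (hℓ ℓ hℓ2)
  have hfW : (W.badPlaces ℤ).Finite := W.finite_badPlaces_holds ℤ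
  have hfW₁ : (W₁.badPlaces ℤ).Finite := W₁.finite_badPlaces_holds ℤ
  set s : Finset (HeightOneSpectrum ℤ) := hfW.toFinset ∪ hfW₁.toFinset with hs
  have hsW : ∀ v, ¬ W.HasGoodReductionAt v → v ∈ s := fun v hv ↦
    Finset.mem_union_left _ (by rw [Set.Finite.mem_toFinset, mem_badPlaces_iff]; exact hv)
  have hsW₁ : ∀ v, ¬ W₁.HasGoodReductionAt v → v ∈ s := fun v hv ↦
    Finset.mem_union_right _ (by rw [Set.Finite.mem_toFinset, mem_badPlaces_iff]; exact hv)
  rw [tamagawaProduct_eq_prod W s hsW, tamagawaProduct_eq_prod W₁ s hsW₁,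
    padicValNat_finset_prod₅ 2 s _ fun v _ ↦ ?_, padicValNat_finset_prod₅ 2 s _ fun v _ ↦ ?_]
  · refine Finset.sum_congr rfl fun v _ ↦ ?_
    haveI := Fact.mk (primesEquiv v).2
    exact hprime (primesEquiv v)
  · haveI := Fact.mk (primesEquiv v).2
    haveI : (W₁.baseChange ℚ_[primesEquiv v]).IsElliptic :=
      inferInstanceAs (W₁.map (algebraMap ℚ ℚ_[primesEquiv v])).IsElliptic
    exact localTamagawaNumber_padic_ne_zero_holds (primesEquiv v) _
  · haveI := Fact.mk (primesEquiv v).2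
    haveI : (W.baseChange ℚ_[primesEquiv v]).IsElliptic :=
      inferInstanceAs (W.map (algebraMap ℚ ℚ_[primesEquiv v])).IsElliptic
    exact localTamagawaNumber_padic_ne_zero_holds (primesEquiv v) _

end Summit.BirchSwinnertonDyer.Uniform.U2

end
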